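import Summits.Parity.GeneralizedHardyLittlewood.Theses.OneSidedAggregateExchangeRate
import Literature.NumberTheory.Sieve.SingularSeriesProofs
import HarnessLib

/-!
# BC3 birth skeleton — crux `ThreePrimeShiftDensity` (K1, rank 2, deciding) of route `OneSidedAggregateExchangeRate`
(Parity / GeneralizedHardyLittlewood; item stmt-Parity-18973)

Line-writer seat `linewriter-parity-certcluster-1` g0, 2026-08-31 (re-authored from the route header's TWO-LAYER PLAN,
`Theses/OneSidedAggregateExchangeRate.lean` "K1 ThreePrimeShiftDensity ⇐ S_a CellMass → S_b RelativeShiftDensity → K1";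
the pre-open birth `bc/ThreePrimeShiftDensity_birth.lean` sha16 ba0ed287… lives gate-side only).

LINE (CellShift).  K1 says `W₃(x) = #{x < n ≤ 2x : n + 2 prime, n = p₁p₂p₃, x^{1/7} ≤ p₁ < p₂ < p₃ ≤ x^{1/2}}
≥ (C₂/10)·x/log²x` for all large `x`.  Factor it through the UNSHIFTED cell `C₃(x) = #{x < n ≤ 2x : n = p₁p₂p₃, same ranges}`:

* `stub_cellMass` (S_a, THEOREM-GRADE, M–L): `C₃(x) ≥ (2/5)·x/log x` for large `x`.  Prime-number-theorem grade
  (Landau's `π₃` asymptotics restricted to a polytope of exponents): `C₃(x) ∼ M₃(1/7)·x/log x` with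
  `M₃(ν) = ∫∫_{ν ≤ u₁ < u₂ < u₃ ≤ 1/2, u₁+u₂+u₃ = 1} du₁du₂/(u₁u₂u₃) = 0.4880…` (certified enclosure `[0.48805, 0.48814]`,
  sketch SKETCH.md §K1), and `2/5 < 0.488` leaves an 18 % margin.  No parity content.
* `stub_relativeShiftDensity` (S_b, IDEA-NEEDED, the open content): `log x · W₃(x) ≥ (C₂/4)·C₃(x)` for large `x` — the shifted
  primes `n + 2` have RELATIVE density at least `C₂/(4 log x)` on the cell, ONE EIGHTH of the Hardy–Littlewood–Selberg expectation
  `2C₂/log x` (uniformly for `n ≤ 2x`, `log(n+2) ≤ log x + 1`).  This is STRONGER than K1 by the constant bookkeeping only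
  (K1 = `1/(20 M₃) ≈ 0.1025` of HL, S_b = `1/8` of HL) and is the dispersion-method target named in the route header: after
  Cauchy over `m = p₁p₂` it is HL for the pairs of linear forms `(ℓ, mℓ + 2)` on average over `m` — Harman's missing Type II for
  `p + 2` [Harman2007 p. 286], [BFI1986], [Drappeau2017]; why it might fail: fixed shift, no variance trick (route header K1).
* Composition (PROVED below): `(C₂/10)·x/log²x = (C₂/4)·((2/5)·x/log x)/log x ≤ (C₂/4)·C₃(x)/log x ≤ W₃(x)`.

Honesty (BC3): neither stub restates K1 — S_a has no shifted prime in it (and is provable), S_b is a RELATIVE statement that does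
not imply K1 without a cell-mass lower bound and is not implied by K1 (K1 allows `W₃ ≥ 0.1025·HL` while S_b asks `1/8·HL`
pointwise-on-average); the summit `GeneralizedHardyLittlewood` is not reachable from either (K1 itself is only 1/10 of one HL
instance from below).
-/

noncomputable section

namespace Summit.Parity.GeneralizedHardyLittlewood.Cruxes.ThreePrimeShiftDensity.Birth

open scoped BigOperators Classical
open Literature.NumberTheory.Sieve
open Summit.Parity.GeneralizedHardyLittlewood.Theses.OneSidedAggregateExchangeRate

/-! ## Vocabulary -/

/-- the three-prime cell `C₃(x)`: `x < n ≤ 2x`, `n = p₁p₂p₃`, `x^{1/7} ≤ p₁ < p₂ < p₃ ≤ x^{1/2}` (K1's set WITHOUT the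
primality of `n + 2`). -/
def cellSet (x : ℕ) : Finset ℕ :=
  (Finset.Ioc x (2 * x)).filter (fun n : ℕ => ∃ p₁ p₂ p₃ : ℕ, p₁.Prime ∧ p₂.Prime ∧ p₃.Prime ∧ n = p₁ * p₂ * p₃ ∧
    (x : ℝ) ^ ((1 : ℝ) / 7) ≤ (p₁ : ℝ) ∧ p₁ < p₂ ∧ p₂ < p₃ ∧ (p₃ : ℝ) ≤ (x : ℝ) ^ ((1 : ℝ) / 2))

/-- the shifted cell `W₃(x)`: K1's set VERBATIM (`n + 2` prime and `n` in the cell). -/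
def shiftedSet (x : ℕ) : Finset ℕ :=
  (Finset.Ioc x (2 * x)).filter (fun n : ℕ => (n + 2).Prime ∧ ∃ p₁ p₂ p₃ : ℕ, p₁.Prime ∧ p₂.Prime ∧ p₃.Prime ∧
    n = p₁ * p₂ * p₃ ∧ (x : ℝ) ^ ((1 : ℝ) / 7) ≤ (p₁ : ℝ) ∧ p₁ < p₂ ∧ p₂ < p₃ ∧ (p₃ : ℝ) ≤ (x : ℝ) ^ ((1 : ℝ) / 2))

/-- K1 unfolded over the vocabulary (PROVED, definitional). -/
theorem threePrimeShiftDensity_iff :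
    ThreePrimeShiftDensity ↔
      ∃ x₀ : ℕ, ∀ x : ℕ, x₀ ≤ x → twinPrimeConst / 10 * (x : ℝ) / Real.log (x : ℝ) ^ 2 ≤ ((shiftedSet x).card : ℝ) :=
  Iff.rfl

/-! ## The two stubs (statements spelled out; `Signature.*` are the same terms by `rfl`, see the `example`s) -/

/-- S_a signature. -/
def Signature.stub_cellMass : Prop :=
  ∃ x₀ : ℕ, ∀ x : ℕ, x₀ ≤ x → 2 / 5 * (x : ℝ) / Real.log (x : ℝ) ≤ ((cellSet x).card : ℝ)

/-- **S_a `stub_cellMass`** (theorem-grade, M–L): the three-prime cell has mass at least `(2/5)·x/log x` for large `x`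
(`C₃(x) ∼ M₃(1/7)·x/log x`, `M₃(1/7) = 0.4880…`; Landau/PNT for products of three primes on the exponent polytope
`1/7 ≤ u₁ < u₂ < u₃ ≤ 1/2`; Mertens-type partial summation twice + PNT in short-ish ranges for `p₃ ∈ (x/(p₁p₂), 2x/(p₁p₂)]`). -/
theorem stub_cellMass :
    ∃ x₀ : ℕ, ∀ x : ℕ, x₀ ≤ x → 2 / 5 * (x : ℝ) / Real.log (x : ℝ) ≤ ((cellSet x).card : ℝ) := by
  sorry

example : Signature.stub_cellMass := stub_cellMass

/-- S_b signature. -/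
def Signature.stub_relativeShiftDensity : Prop :=
  ∃ x₀ : ℕ, ∀ x : ℕ, x₀ ≤ x → twinPrimeConst / 4 * ((cellSet x).card : ℝ) ≤ Real.log (x : ℝ) * ((shiftedSet x).card : ℝ)

/-- **S_b `stub_relativeShiftDensity`** (IDEA-NEEDED, the open content of K1): on the three-prime cell the shift `n ↦ n + 2`
hits the primes with relative density at least `C₂/(4·log x)` — one eighth of the Hardy–Littlewood–Selberg expectation
`𝔖/log x = 2C₂/log x`: `log x · W₃(x) ≥ (C₂/4)·C₃(x)` for large `x`.  Dispersion target: bilinear structure `n = mℓ`,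
`m = p₁p₂ ≤ x^{2/3}`, `ℓ = p₃ ∈ [x^{1/3}, x^{1/2}]`; a LOWER bound only (Harman-type role reversals / a positive-proportion
minorant for `ℓ ↦ Λ(mℓ+2)` on average over `m` would suffice). -/
theorem stub_relativeShiftDensity :
    ∃ x₀ : ℕ, ∀ x : ℕ, x₀ ≤ x →
      twinPrimeConst / 4 * ((cellSet x).card : ℝ) ≤ Real.log (x : ℝ) * ((shiftedSet x).card : ℝ) := by
  sorry

example : Signature.stub_relativeShiftDensity := stub_relativeShiftDensity

/-! ## Composition (kernel-checked) -/

/-- **K1 from the two stubs** (PROVED): `(C₂/10)·x/log²x = (C₂/4)·((2/5)·x/log x)/log x ≤ (C₂/4)·C₃(x)/log x ≤ W₃(x)`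
for `x ≥ max(x₀, x₁, 2)` (`log x > 0`, `C₂ > 0` = `twinPrimeConst_pos_holds`). -/
theorem ThreePrimeShiftDensity_of :
    Signature.stub_cellMass → Signature.stub_relativeShiftDensity → ThreePrimeShiftDensity := by
  rintro ⟨x₀, h₀⟩ ⟨x₁, h₁⟩
  rw [threePrimeShiftDensity_iff]
  refine ⟨max (max x₀ x₁) 2, fun x hx => ?_⟩
  have hx₀ : x₀ ≤ x := le_trans (le_trans (le_max_left _ _) (le_max_left _ _)) hx
  have hx₁ : x₁ ≤ x := le_trans (le_trans (le_max_right _ _) (le_max_left _ _)) hx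
  have hx2 : (2 : ℕ) ≤ x := le_trans (le_max_right _ _) hx
  have hxR : (2 : ℝ) ≤ (x : ℝ) := by exact_mod_cast hx2
  have hL : 0 < Real.log (x : ℝ) := Real.log_pos (by linarith)
  have hC₂pos : 0 < twinPrimeConst := twinPrimeConst_pos_holds
  have hA := h₀ x hx₀
  have hB := h₁ x hx₁
  set L : ℝ := Real.log (x : ℝ) with hLdef
  set C : ℝ := ((cellSet x).card : ℝ)
  set W : ℝ := ((shiftedSet x).card : ℝ)
  -- (C₂/10)·x/L ≤ (C₂/4)·C ≤ L·W
  have e1 : twinPrimeConst / 10 * (x : ℝ) / L ≤ L * W := by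
    calc twinPrimeConst / 10 * (x : ℝ) / L = twinPrimeConst / 4 * (2 / 5 * (x : ℝ) / L) := by ring
      _ ≤ twinPrimeConst / 4 * C := by
          exact mul_le_mul_of_nonneg_left hA (by positivity)
      _ ≤ L * W := hB
  -- divide by L > 0
  rw [div_le_iff₀ (pow_pos hL 2)]
  have e2 : twinPrimeConst / 10 * (x : ℝ) ≤ L * W * L := by
    rwa [div_le_iff₀ hL] at e1
  nlinarith [e2]

/-- **The skeleton instantiated**: K1 BY NAME modulo the two registered stubs (carries exactly their `sorry`s). -/
theorem ThreePrimeShiftDensity_of_stubs : ThreePrimeShiftDensity :=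
  ThreePrimeShiftDensity_of stub_cellMass stub_relativeShiftDensity

end Summit.Parity.GeneralizedHardyLittlewood.Cruxes.ThreePrimeShiftDensity.Birth

end
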